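import Summits.CriticalPhenomena.PercolationContinuityZ3.Theorems.Transplant.FKConnectivityAllQForestClawDecomposition
import HarnessLib

/-!
# The TRIANGLE-CLAW REDUCTION of the square-free adjacent forest Rayleigh node (♣)⁰

Support file (`--supports stmt-CriticalPhenomena-4575`), FK sub-lane `prim-bschramm-fk-1` (generation 23) of the post-continuity programme;
builds on p205010 (kernel theorem, internal audit signed; external expert review pending).  No definitions, no named facts, no sorries;
standard axioms.

NODE (`AdjForestRayleighNoSqOn`, fk-1 g16–g22): on every fibre `(M, u₀)` and for `e = ov`, `f = oy`,
`#(Fo ∩ {e, f ∈ ω}, Fo) ≤ #(Fo ∩ {e ∈ ω}, Fo ∩ {f ∈ ω})` (`Fo` = forest configurations; in a uniformly random ordered partition of a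
multigraph into two forests two adjacent pairs are negatively correlated).  Open in general.

THIS FILE (new reduction, memo bschramm/FROM-fk-1-g23-VERTEX-ELIMINATION.md §2).  Let `z ∉ e, f` be a vertex whose pairs in the fibre are
exactly three FREE pairs `za, zb, zc`, and suppose the two feet `a, b` are joined by a FREE pair `ab ≠ e, f` of the fibre (a degree-3 vertex
in a triangle, anywhere in the graph).  In the claw decomposition (`fibreCount_forest_claw_decomp`) the two CLAW terms — configuration (or
partner) containing the whole claw and hence separating `a, b, c` pairwise — then force `ab` into the other class, where `z` is isolated:
moving `zb ↦ ab` (same connectivity, since `za` is present) and hanging `za` onto the other class identifies the two claw terms with the two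
halves `{zc ∈ ω}`, `{zc ∉ ω}` of the plain count on the fibre `((M' ∖ {ab}) ∪ {zc}, u₀ ∪ {za, ab})` (`za, ab` PINNED = contracted):
**`fibreCount_forest_claw_eq_pinned`**, **`fibreCount_forest_triangleClaw_decomp`**
  `#_{(M,u₀)} = #_{(M'−ab+zc, u₀+za+ab)} + 2·#_{(M'−ab, u₀+ab)} + [ac-conditioned terms] + [bc-conditioned terms]`
(an identity for all events blind to `za, zb, zc, ab`; in graph language `Φ(G) = ½Φ(G/za) + Φ(G−z+ab) + Φ(G−z+ac) + Φ(G−z+bc)` for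
`Φ = Bad − Good`).  Hence **`adjForestNoSq_fibre_of_triangleClaw`**: the node's inequality on the two pinned fibres and the two conditioned
pair inequalities imply it on `(M, u₀)`; **`adjForestNoSq_fibre_of_triangleClaw_free`**: when `ac, bc` are not pairs of the fibre the
hypotheses are the node on FOUR SMALLER FIBRES `(M'−ab+zc, u₀+za+ab)`, `(M'−ab, u₀+ab)`, `(M'+ac, u₀)`, `(M'+bc, u₀)` — (♣)⁰ is closed under
adding a degree-3 vertex two of whose neighbours are adjacent.  CENSUS (seat numerics, exact): among 3-connected Laman-sparse instances the
reduction covers what no earlier tree theorem covers in 46 / 864 / 13,779 instances at n = 7 / 8 / 9; the uncovered 3-connected Laman-sparse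
frontier drops from 12 / 182 / 2,423 to 8 / 53 / 395 instances.
[cite: SempleWelsh2008, Conj. 1.1 (p. 2)] [cite: Linusson2011, Prop. 2.6] [cite: Grimmett2006, §1.5 (p. 13)]
-/

noncomputable section

namespace Summit.CriticalPhenomena.PercolationContinuityZ3.Theorems
namespace FK

open MeasureTheory Set Literature.Probability.LatticeModels Literature.Probability.Percolation
open scoped Classical symmDiff

variable {V : Type*} [Fintype V]

section TriangleClaw

variable {N u₀ : BondConfig V} {z a b c : V} {P Q : Set (BondConfig V)}

/-- **The claw term is a pinned count.**  `z` isolated in `N ∪ u₀`, `ab ∉ N ∪ u₀`, `z, a, b, c` distinct, `P, Q` blind to `za, zc, ab`: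
`#_{(N ∪ {ab}, u₀)}(Fo ∩ {a ↮ b, a ↮ c, b ↮ c} ∩ P, Fo ∩ Q) = #_{(N ∪ {zc}, u₀ ∪ {za, ab})}(Fo ∩ P ∩ {zc ∈ ω}, Fo ∩ Q)`.
[cite: Linusson2011, Prop. 2.6] [cite: Grimmett2006, §1.5 (p. 13)] -/
theorem fibreCount_forest_claw_eq_pinned (hz : ∀ g ∈ N ∪ u₀, z ∉ g) (habN : s(a, b) ∉ N) (habu : s(a, b) ∉ u₀)
    (hza : z ≠ a) (hzb : z ≠ b) (hzc : z ≠ c) (hab : a ≠ b) (hac : a ≠ c)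
    (hPa : ∀ ω, insert s(z, a) ω ∈ P ↔ ω ∈ P) (hPc : ∀ ω, insert s(z, c) ω ∈ P ↔ ω ∈ P) (hPab : ∀ ω, insert s(a, b) ω ∈ P ↔ ω ∈ P)
    (hQa : ∀ ω, insert s(z, a) ω ∈ Q ↔ ω ∈ Q) (hQab : ∀ ω, insert s(a, b) ω ∈ Q ↔ ω ∈ Q) :
    fibreCount (insert s(a, b) N) u₀ (forestEv V ∩ {ω | ¬ (openGraph ω).Reachable a b ∧ ¬ (openGraph ω).Reachable a c ∧
        ¬ (openGraph ω).Reachable b c} ∩ P) (forestEv V ∩ Q) =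
      fibreCount (insert s(z, c) N) (insert s(z, a) (insert s(a, b) u₀)) (forestEv V ∩ P ∩ {ω | s(z, c) ∈ ω}) (forestEv V ∩ Q) := by
  have hzcN : s(z, c) ∉ N := fun h => hz _ (Or.inl h) (Sym2.mem_mk_left _ _)
  have hzaM : s(z, a) ∉ insert s(z, c) N := by
    rw [mem_insert_iff, not_or]
    exact ⟨fun h => hac (Sym2.congr_right.1 h), fun h => hz _ (Or.inl h) (Sym2.mem_mk_left _ _)⟩
  have hzab : s(z, a) ≠ s(a, b) := fun h => hzb ((Sym2.mem_iff.1 (h ▸ Sym2.mem_mk_left z a)).elim (fun h' => absurd h' hza) id)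
  have hzcab : s(z, c) ≠ s(a, b) := fun h =>
    ((Sym2.mem_iff.1 (h ▸ Sym2.mem_mk_left z c)).elim (fun h' => hza h') (fun h' => hzb h'))
  have hzau : s(z, a) ∉ insert s(a, b) u₀ := by
    rw [mem_insert_iff, not_or]
    exact ⟨hzab, fun h => hz _ (Or.inr h) (Sym2.mem_mk_left _ _)⟩
  have habM : s(a, b) ∉ insert s(z, c) N := by
    rw [mem_insert_iff, not_or]; exact ⟨fun h => hzcab h.symm, habN⟩
  have hca : s(z, c) ≠ s(z, a) := fun h => hac (Sym2.congr_right.1 h).symm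
  -- on the fibre `(N, u₀)`: `z` isolated, `ab` absent, on both sides
  have hfib : ∀ {ω : BondConfig V}, ω \ N = u₀ →
      ((∀ g ∈ ω, z ∉ g) ∧ s(a, b) ∉ ω ∧ s(z, c) ∉ ω) ∧ ((∀ g ∈ ω ∆ N, z ∉ g) ∧ s(a, b) ∉ ω ∆ N ∧ s(z, c) ∉ ω ∆ N) := by
    intro ω hω
    obtain ⟨h1, h2⟩ := subset_union_of_fibre hω
    refine ⟨⟨fun g hg => hz g (h1 hg), fun h => (h1 h).elim habN habu, fun h => hz _ (h1 h) (Sym2.mem_mk_left _ _)⟩,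
      ⟨fun g hg => hz g (h2 hg), fun h => (h2 h).elim habN habu, fun h => hz _ (h2 h) (Sym2.mem_mk_left _ _)⟩⟩
  -- forests: the claw-with-`ab` and the leaf `za` at the isolated vertex
  have hclaw : ∀ {ξ : BondConfig V}, (∀ g ∈ ξ, z ∉ g) → s(a, b) ∉ ξ →
      (IsForestCfg (insert s(z, a) (insert s(a, b) (insert s(z, c) ξ))) ↔
        IsForestCfg ξ ∧ ¬ (openGraph ξ).Reachable a b ∧ ¬ (openGraph ξ).Reachable a c ∧ ¬ (openGraph ξ).Reachable b c) := by
    intro ξ hξ habξ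
    have hiso' : ∀ g ∈ insert s(a, b) ξ, z ∉ g := by
      rintro g hg hzg
      rcases mem_insert_iff.1 hg with rfl | hg
      · rcases Sym2.mem_iff.1 hzg with h | h
        · exact hza h
        · exact hzb h
      · exact hξ g hg hzg
    rw [Set.insert_comm s(a, b), isForestCfg_insert_two_of_isolated hiso' hzc hza hac.symm, isForestCfg_insert_iff hab habξ,
      KNSep.reachable_insert_iff]
    simp only [SimpleGraph.Reachable.refl, and_true, SimpleGraph.reachable_comm (u := c)]
    tauto
  have hleaf : ∀ {ξ : BondConfig V}, (∀ g ∈ ξ, z ∉ g) → s(a, b) ∉ ξ →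
      (IsForestCfg (insert s(z, a) (insert s(a, b) ξ)) ↔ IsForestCfg ξ ∧ ¬ (openGraph ξ).Reachable a b) := by
    intro ξ hξ habξ
    have hiso' : ∀ g ∈ insert s(a, b) ξ, z ∉ g := by
      rintro g hg hzg
      rcases mem_insert_iff.1 hg with rfl | hg
      · rcases Sym2.mem_iff.1 hzg with h | h
        · exact hza h
        · exact hzb h
      · exact hξ g hg hzg
    rw [isForestCfg_insert_of_isolated hiso' hza, isForestCfg_insert_iff hab habξ]
  -- left: peel the free pair `ab`; the branch `ab ∈ ω` is empty
  rw [fibreCount_insert_one habN]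
  have e0 : fibreCount N u₀ ({ω | s(a, b) ∉ ω} ∩ {ω | insert s(a, b) ω ∈ forestEv V ∩ {ω | ¬ (openGraph ω).Reachable a b ∧
      ¬ (openGraph ω).Reachable a c ∧ ¬ (openGraph ω).Reachable b c} ∩ P}) ({ω | s(a, b) ∉ ω} ∩ (forestEv V ∩ Q)) = 0 := by
    refine fibreCount_eq_zero_of_left N u₀ ?_ _
    rw [Set.eq_empty_iff_forall_notMem]
    rintro ω ⟨-, ⟨-, hsep, -⟩, -⟩
    exact hsep ((openGraph_adj _ _ _).2 ⟨mem_insert _ _, hab⟩).reachable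
  rw [e0, zero_add]
  -- right: peel the pinned pairs `za`, `ab`, then the free pair `zc`; the branch `zc ∉ ω` is empty
  rw [fibreCount_insert_pinned hzaM hzau, fibreCount_insert_pinned habM habu, fibreCount_insert_one hzcN]
  have e1 : fibreCount N u₀ ({ω | s(z, c) ∉ ω} ∩ {ω | insert s(a, b) ω ∈ {ω | insert s(z, a) ω ∈ forestEv V ∩ P ∩ {ω | s(z, c) ∈ ω}}})
      ({ω | s(z, c) ∉ ω} ∩ {ω | insert s(z, c) ω ∈ {ζ | insert s(a, b) ζ ∈ {ζ | insert s(z, a) ζ ∈ forestEv V ∩ Q}}}) = 0 := by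
    refine fibreCount_eq_zero_of_left N u₀ ?_ _
    rw [Set.eq_empty_iff_forall_notMem]
    rintro ω ⟨hc, ⟨-, hmem⟩⟩
    simp only [mem_setOf_eq, mem_insert_iff, hca, hzcab, false_or] at hmem
    exact hc hmem
  rw [e1, add_zero]
  refine fibreCount_congr_fibre _ _ fun ω hω => ?_
  obtain ⟨⟨i1, n1, c1⟩, ⟨i2, n2, c2⟩⟩ := hfib hω
  simp only [mem_inter_iff, mem_setOf_eq, forestEv, mem_insert_iff, hclaw i1 n1, hleaf i2 n2, hPa, hPab, hPc, hQa, hQab,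
    isForestCfg_insert_iff hab n2, n1, n2, c1, c2, hca, hzcab, not_false_eq_true, true_and, true_or, and_true, false_or]

/-- **TRIANGLE-CLAW DECOMPOSITION.**  `z` isolated in `N ∪ u₀`, `ab ∉ N ∪ u₀`, `z, a, b, c` distinct, `P, Q` blind to `za, zb, zc, ab`.
On the fibre `(N ∪ {ab, za, zb, zc}, u₀)` (a degree-3 vertex `z` two of whose feet are joined by the free pair `ab`):
`#(Fo ∩ P, Fo ∩ Q) = #_{(N+zc, u₀+za+ab)}(Fo ∩ P, Fo ∩ Q) + 2·#_{(N, u₀+ab)}(Fo ∩ P, Fo ∩ Q) + Σ_{pq ∈ {ac, bc}} [#_{(N+ab,u₀)}(Fo ∩ {p ↮ q} ∩ P, Fo ∩ Q) + #_{(N+ab,u₀)}(Fo ∩ P, Fo ∩ {p ↮ q} ∩ Q)]`.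
Graph form: `Φ(G) = ½Φ(G/za) + Φ(G−z+ab) + Φ(G−z+ac) + Φ(G−z+bc)` for every signed pair statistic `Φ`.
[cite: SempleWelsh2008, Conj. 1.1 (p. 2)] [cite: Linusson2011, Prop. 2.6] [cite: Grimmett2006, §1.5 (p. 13)] -/
theorem fibreCount_forest_triangleClaw_decomp (hz : ∀ g ∈ N ∪ u₀, z ∉ g) (habN : s(a, b) ∉ N) (habu : s(a, b) ∉ u₀)
    (hza : z ≠ a) (hzb : z ≠ b) (hzc : z ≠ c) (hab : a ≠ b) (hac : a ≠ c) (hbc : b ≠ c)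
    (hPa : ∀ ω, insert s(z, a) ω ∈ P ↔ ω ∈ P) (hPb : ∀ ω, insert s(z, b) ω ∈ P ↔ ω ∈ P) (hPc : ∀ ω, insert s(z, c) ω ∈ P ↔ ω ∈ P)
    (hPab : ∀ ω, insert s(a, b) ω ∈ P ↔ ω ∈ P)
    (hQa : ∀ ω, insert s(z, a) ω ∈ Q ↔ ω ∈ Q) (hQb : ∀ ω, insert s(z, b) ω ∈ Q ↔ ω ∈ Q) (hQc : ∀ ω, insert s(z, c) ω ∈ Q ↔ ω ∈ Q)
    (hQab : ∀ ω, insert s(a, b) ω ∈ Q ↔ ω ∈ Q) :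
    fibreCount (insert s(z, a) (insert s(z, b) (insert s(z, c) (insert s(a, b) N)))) u₀ (forestEv V ∩ P) (forestEv V ∩ Q) =
      fibreCount (insert s(z, c) N) (insert s(z, a) (insert s(a, b) u₀)) (forestEv V ∩ P) (forestEv V ∩ Q) +
      (fibreCount N (insert s(a, b) u₀) (forestEv V ∩ P) (forestEv V ∩ Q) +
        fibreCount N (insert s(a, b) u₀) (forestEv V ∩ P) (forestEv V ∩ Q)) +
      (fibreCount (insert s(a, b) N) u₀ (forestEv V ∩ {ω | ¬ (openGraph ω).Reachable a c} ∩ P) (forestEv V ∩ Q) +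
        fibreCount (insert s(a, b) N) u₀ (forestEv V ∩ P) (forestEv V ∩ {ω | ¬ (openGraph ω).Reachable a c} ∩ Q)) +
      (fibreCount (insert s(a, b) N) u₀ (forestEv V ∩ {ω | ¬ (openGraph ω).Reachable b c} ∩ P) (forestEv V ∩ Q) +
        fibreCount (insert s(a, b) N) u₀ (forestEv V ∩ P) (forestEv V ∩ {ω | ¬ (openGraph ω).Reachable b c} ∩ Q)) := by
  have hz' : ∀ g ∈ insert s(a, b) N ∪ u₀, z ∉ g := by
    rintro g hg hzg
    rcases hg with hg | hg
    · rcases mem_insert_iff.1 hg with rfl | hg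
      · rcases Sym2.mem_iff.1 hzg with h | h
        · exact hza h
        · exact hzb h
      · exact hz g (Or.inl hg) hzg
    · exact hz g (Or.inr hg) hzg
  rw [fibreCount_forest_claw_decomp hz' hza hzb hzc hab hac hbc hPa hPb hPc hQa hQb hQc]
  have hzc' : ∀ {ω : BondConfig V}, s(z, c) ∈ ω ∆ insert s(z, c) N ↔ s(z, c) ∉ ω := fun {ω} => by
    rw [Set.mem_symmDiff]
    have := mem_insert s(z, c) N
    tauto
  -- the two claw terms are the two halves of the pinned count
  have k1 := fibreCount_forest_claw_eq_pinned hz habN habu hza hzb hzc hab hac hPa hPc hPab hQa hQab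
  have k2 : fibreCount (insert s(a, b) N) u₀ (forestEv V ∩ P) (forestEv V ∩ {ω | ¬ (openGraph ω).Reachable a b ∧
      ¬ (openGraph ω).Reachable a c ∧ ¬ (openGraph ω).Reachable b c} ∩ Q) =
      fibreCount (insert s(z, c) N) (insert s(z, a) (insert s(a, b) u₀)) (forestEv V ∩ P ∩ {ω | s(z, c) ∉ ω}) (forestEv V ∩ Q) := by
    rw [fibreCount_swap, fibreCount_forest_claw_eq_pinned hz habN habu hza hzb hzc hab hac hQa hQc hQab hPa hPab, fibreCount_swap]
    refine fibreCount_congr_fibre _ _ fun ω hω => ?_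
    simp only [mem_inter_iff, mem_setOf_eq, hzc']
    tauto
  have hd : Disjoint (forestEv V ∩ P ∩ {ω | s(z, c) ∈ ω}) (forestEv V ∩ P ∩ {ω | s(z, c) ∉ ω}) :=
    Set.disjoint_left.2 fun ω h₁ h₂ => h₂.2 h₁.2
  have k12 : fibreCount (insert s(a, b) N) u₀ (forestEv V ∩ {ω | ¬ (openGraph ω).Reachable a b ∧ ¬ (openGraph ω).Reachable a c ∧
        ¬ (openGraph ω).Reachable b c} ∩ P) (forestEv V ∩ Q) +
      fibreCount (insert s(a, b) N) u₀ (forestEv V ∩ P) (forestEv V ∩ {ω | ¬ (openGraph ω).Reachable a b ∧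
        ¬ (openGraph ω).Reachable a c ∧ ¬ (openGraph ω).Reachable b c} ∩ Q) =
      fibreCount (insert s(z, c) N) (insert s(z, a) (insert s(a, b) u₀)) (forestEv V ∩ P) (forestEv V ∩ Q) := by
    rw [k1, k2, ← fibreCount_split_left _ _ _ hd]
    exact fibreCount_congr_fibre _ _ fun ω hω => by
      simp only [mem_union, mem_inter_iff, mem_setOf_eq]
      tauto
  -- the two `ab` terms are the count with `ab` pinned
  have k3 : fibreCount (insert s(a, b) N) u₀ (forestEv V ∩ {ω | ¬ (openGraph ω).Reachable a b} ∩ P) (forestEv V ∩ Q) =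
      fibreCount N (insert s(a, b) u₀) (forestEv V ∩ P) (forestEv V ∩ Q) :=
    fibreCount_forest_sep_of_mem hab habN habu hPab hQab
  have k4 : fibreCount (insert s(a, b) N) u₀ (forestEv V ∩ P) (forestEv V ∩ {ω | ¬ (openGraph ω).Reachable a b} ∩ Q) =
      fibreCount N (insert s(a, b) u₀) (forestEv V ∩ P) (forestEv V ∩ Q) := by
    rw [fibreCount_swap, fibreCount_forest_sep_of_mem hab habN habu hQab hPab, fibreCount_swap]
  rw [k12, k3, k4]

end TriangleClaw

/-! ### The node across a triangle claw -/

section Node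

variable {N u₀ : BondConfig V} {z a b c : V} {e f : Sym2 V}

omit [Fintype V] in
/-- Pair events are blind to other pairs. [folklore] -/
theorem insert_mem_pairEv_iff {g e : Sym2 V} (hge : g ≠ e) (ω : BondConfig V) :
    insert g ω ∈ {ω : BondConfig V | e ∈ ω} ↔ ω ∈ {ω : BondConfig V | e ∈ ω} := by
  simp only [mem_setOf_eq, mem_insert_iff, hge.symm, false_or]

omit [Fintype V] in
/-- Two-pair events are blind to other pairs. [folklore] -/
theorem insert_mem_pairEv₂_iff {g e f : Sym2 V} (hge : g ≠ e) (hgf : g ≠ f) (ω : BondConfig V) :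
    insert g ω ∈ {ω : BondConfig V | e ∈ ω ∧ f ∈ ω} ↔ ω ∈ {ω : BondConfig V | e ∈ ω ∧ f ∈ ω} := by
  simp only [mem_setOf_eq, mem_insert_iff, hge.symm, hgf.symm, false_or]

/-- **(♣)⁰ ACROSS A TRIANGLE CLAW (conditioned form).**  Fibre `(N ∪ {ab, za, zb, zc}, u₀)`: `z` isolated in `N ∪ u₀`, `ab ∉ N ∪ u₀`
free, `z, a, b, c` distinct, `z ∉ e, f`, `ab ≠ e, f`.  If the node's inequality holds on the pinned fibres `(N ∪ {zc}, u₀ ∪ {za, ab})` and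
`(N, u₀ ∪ {ab})`, and the two conditioned pair inequalities (pairs `ac`, `bc`) hold on `(N ∪ {ab}, u₀)`, then the node's inequality
`#(Fo ∩ {e,f ∈ ω}, Fo) ≤ #(Fo ∩ {e ∈ ω}, Fo ∩ {f ∈ ω})` holds on `(N ∪ {ab, za, zb, zc}, u₀)`.
[cite: SempleWelsh2008, Conj. 1.1 (p. 2)] [cite: Linusson2011, Prop. 2.6] [cite: Grimmett2006, §1.5 (p. 13)] -/
theorem adjForestNoSq_fibre_of_triangleClaw (hz : ∀ g ∈ N ∪ u₀, z ∉ g) (habN : s(a, b) ∉ N) (habu : s(a, b) ∉ u₀)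
    (hza : z ≠ a) (hzb : z ≠ b) (hzc : z ≠ c) (hab : a ≠ b) (hac : a ≠ c) (hbc : b ≠ c)
    (hez : z ∉ e) (hfz : z ∉ f) (heab : s(a, b) ≠ e) (hfab : s(a, b) ≠ f)
    (H1 : fibreCount (insert s(z, c) N) (insert s(z, a) (insert s(a, b) u₀)) (forestEv V ∩ {ω | e ∈ ω ∧ f ∈ ω}) (forestEv V) ≤
      fibreCount (insert s(z, c) N) (insert s(z, a) (insert s(a, b) u₀)) (forestEv V ∩ {ω | e ∈ ω}) (forestEv V ∩ {ω | f ∈ ω}))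
    (H2 : fibreCount N (insert s(a, b) u₀) (forestEv V ∩ {ω | e ∈ ω ∧ f ∈ ω}) (forestEv V) ≤
      fibreCount N (insert s(a, b) u₀) (forestEv V ∩ {ω | e ∈ ω}) (forestEv V ∩ {ω | f ∈ ω}))
    (Hac : fibreCount (insert s(a, b) N) u₀ (forestEv V ∩ {ω | ¬ (openGraph ω).Reachable a c} ∩ {ω | e ∈ ω ∧ f ∈ ω}) (forestEv V) +
        fibreCount (insert s(a, b) N) u₀ (forestEv V ∩ {ω | e ∈ ω ∧ f ∈ ω}) (forestEv V ∩ {ω | ¬ (openGraph ω).Reachable a c}) ≤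
      fibreCount (insert s(a, b) N) u₀ (forestEv V ∩ {ω | ¬ (openGraph ω).Reachable a c} ∩ {ω | e ∈ ω}) (forestEv V ∩ {ω | f ∈ ω}) +
        fibreCount (insert s(a, b) N) u₀ (forestEv V ∩ {ω | e ∈ ω}) (forestEv V ∩ {ω | ¬ (openGraph ω).Reachable a c} ∩ {ω | f ∈ ω}))
    (Hbc : fibreCount (insert s(a, b) N) u₀ (forestEv V ∩ {ω | ¬ (openGraph ω).Reachable b c} ∩ {ω | e ∈ ω ∧ f ∈ ω}) (forestEv V) +
        fibreCount (insert s(a, b) N) u₀ (forestEv V ∩ {ω | e ∈ ω ∧ f ∈ ω}) (forestEv V ∩ {ω | ¬ (openGraph ω).Reachable b c}) ≤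
      fibreCount (insert s(a, b) N) u₀ (forestEv V ∩ {ω | ¬ (openGraph ω).Reachable b c} ∩ {ω | e ∈ ω}) (forestEv V ∩ {ω | f ∈ ω}) +
        fibreCount (insert s(a, b) N) u₀ (forestEv V ∩ {ω | e ∈ ω}) (forestEv V ∩ {ω | ¬ (openGraph ω).Reachable b c} ∩ {ω | f ∈ ω})) :
    fibreCount (insert s(z, a) (insert s(z, b) (insert s(z, c) (insert s(a, b) N)))) u₀ (forestEv V ∩ {ω | e ∈ ω ∧ f ∈ ω}) (forestEv V) ≤
      fibreCount (insert s(z, a) (insert s(z, b) (insert s(z, c) (insert s(a, b) N)))) u₀ (forestEv V ∩ {ω | e ∈ ω})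
        (forestEv V ∩ {ω | f ∈ ω}) := by
  have hne : ∀ x : V, s(z, x) ≠ e := fun x h => hez (h ▸ Sym2.mem_mk_left _ _)
  have hnf : ∀ x : V, s(z, x) ≠ f := fun x h => hfz (h ▸ Sym2.mem_mk_left _ _)
  have hU : ∀ (g : Sym2 V) (ω : BondConfig V), insert g ω ∈ (univ : Set (BondConfig V)) ↔ ω ∈ (univ : Set (BondConfig V)) :=
    fun g ω => by simp only [mem_univ]
  have D := fibreCount_forest_triangleClaw_decomp hz habN habu hza hzb hzc hab hac hbc
    (insert_mem_pairEv₂_iff (hne a) (hnf a)) (insert_mem_pairEv₂_iff (hne b) (hnf b)) (insert_mem_pairEv₂_iff (hne c) (hnf c))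
    (insert_mem_pairEv₂_iff heab hfab) (hU _) (hU _) (hU _) (hU _)
  have D' := fibreCount_forest_triangleClaw_decomp hz habN habu hza hzb hzc hab hac hbc
    (insert_mem_pairEv_iff (hne a)) (insert_mem_pairEv_iff (hne b)) (insert_mem_pairEv_iff (hne c)) (insert_mem_pairEv_iff heab)
    (insert_mem_pairEv_iff (hnf a)) (insert_mem_pairEv_iff (hnf b)) (insert_mem_pairEv_iff (hnf c)) (insert_mem_pairEv_iff hfab)
  simp only [Set.inter_univ] at D
  rw [D, D']
  omega

/-- **(♣)⁰ IS CLOSED UNDER ADDING A DEGREE-3 VERTEX IN A TRIANGLE (fibre form, free side pairs).**  Setting of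
`adjForestNoSq_fibre_of_triangleClaw` with the side pairs `ac, bc` outside `N ∪ u₀` and different from `e, f`.  If the node's inequality holds
on the four smaller fibres `(N ∪ {zc}, u₀ ∪ {za, ab})`, `(N, u₀ ∪ {ab})`, `(N ∪ {ab, ac}, u₀)`, `(N ∪ {ab, bc}, u₀)`, then it holds on
`(N ∪ {ab, za, zb, zc}, u₀)`.  (Graph form: `Φ(G) = ½Φ(G/za) + Φ(G−z+ab) + Φ(G−z+ac) + Φ(G−z+bc)`, `Φ = Bad − Good`.)
[cite: SempleWelsh2008, Conj. 1.1 (p. 2)] [cite: Linusson2011, Prop. 2.6] [cite: Grimmett2006, §1.5 (p. 13)] -/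
theorem adjForestNoSq_fibre_of_triangleClaw_free (hz : ∀ g ∈ N ∪ u₀, z ∉ g) (habN : s(a, b) ∉ N) (habu : s(a, b) ∉ u₀)
    (hacN : s(a, c) ∉ N) (hacu : s(a, c) ∉ u₀) (hbcN : s(b, c) ∉ N) (hbcu : s(b, c) ∉ u₀)
    (hza : z ≠ a) (hzb : z ≠ b) (hzc : z ≠ c) (hab : a ≠ b) (hac : a ≠ c) (hbc : b ≠ c)
    (hez : z ∉ e) (hfz : z ∉ f) (heab : s(a, b) ≠ e) (hfab : s(a, b) ≠ f) (heac : s(a, c) ≠ e) (hfac : s(a, c) ≠ f)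
    (hebc : s(b, c) ≠ e) (hfbc : s(b, c) ≠ f)
    (H1 : fibreCount (insert s(z, c) N) (insert s(z, a) (insert s(a, b) u₀)) (forestEv V ∩ {ω | e ∈ ω ∧ f ∈ ω}) (forestEv V) ≤
      fibreCount (insert s(z, c) N) (insert s(z, a) (insert s(a, b) u₀)) (forestEv V ∩ {ω | e ∈ ω}) (forestEv V ∩ {ω | f ∈ ω}))
    (H2 : fibreCount N (insert s(a, b) u₀) (forestEv V ∩ {ω | e ∈ ω ∧ f ∈ ω}) (forestEv V) ≤
      fibreCount N (insert s(a, b) u₀) (forestEv V ∩ {ω | e ∈ ω}) (forestEv V ∩ {ω | f ∈ ω}))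
    (H3 : fibreCount (insert s(a, c) (insert s(a, b) N)) u₀ (forestEv V ∩ {ω | e ∈ ω ∧ f ∈ ω}) (forestEv V) ≤
      fibreCount (insert s(a, c) (insert s(a, b) N)) u₀ (forestEv V ∩ {ω | e ∈ ω}) (forestEv V ∩ {ω | f ∈ ω}))
    (H4 : fibreCount (insert s(b, c) (insert s(a, b) N)) u₀ (forestEv V ∩ {ω | e ∈ ω ∧ f ∈ ω}) (forestEv V) ≤
      fibreCount (insert s(b, c) (insert s(a, b) N)) u₀ (forestEv V ∩ {ω | e ∈ ω}) (forestEv V ∩ {ω | f ∈ ω})) :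
    fibreCount (insert s(z, a) (insert s(z, b) (insert s(z, c) (insert s(a, b) N)))) u₀ (forestEv V ∩ {ω | e ∈ ω ∧ f ∈ ω}) (forestEv V) ≤
      fibreCount (insert s(z, a) (insert s(z, b) (insert s(z, c) (insert s(a, b) N)))) u₀ (forestEv V ∩ {ω | e ∈ ω})
        (forestEv V ∩ {ω | f ∈ ω}) := by
  have hU : ∀ (g : Sym2 V) (ω : BondConfig V), insert g ω ∈ (univ : Set (BondConfig V)) ↔ ω ∈ (univ : Set (BondConfig V)) :=
    fun g ω => by simp only [mem_univ]
  have hacM : s(a, c) ∉ insert s(a, b) N := by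
    rw [mem_insert_iff, not_or]; exact ⟨fun h => hbc (Sym2.congr_right.1 h).symm, hacN⟩
  have hbcM : s(b, c) ∉ insert s(a, b) N := by
    rw [mem_insert_iff, not_or]
    refine ⟨fun h => ?_, hbcN⟩
    have hc : c ∈ s(a, b) := h ▸ Sym2.mem_mk_right b c
    exact (Sym2.mem_iff.1 hc).elim (fun h' => hac h'.symm) (fun h' => hbc h'.symm)
  refine adjForestNoSq_fibre_of_triangleClaw hz habN habu hza hzb hzc hab hac hbc hez hfz heab hfab H1 H2 ?_ ?_
  · have A := fibreCount_forest_sep_add_of_notMem hac hacM hacu (insert_mem_pairEv₂_iff heac hfac) (hU _)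
    have B := fibreCount_forest_sep_add_of_notMem hac hacM hacu (insert_mem_pairEv_iff heac) (insert_mem_pairEv_iff hfac)
    simp only [Set.inter_univ] at A
    rw [A, B]; exact H3
  · have A := fibreCount_forest_sep_add_of_notMem hbc hbcM hbcu (insert_mem_pairEv₂_iff hebc hfbc) (hU _)
    have B := fibreCount_forest_sep_add_of_notMem hbc hbcM hbcu (insert_mem_pairEv_iff hebc) (insert_mem_pairEv_iff hfbc)
    simp only [Set.inter_univ] at A
    rw [A, B]; exact H4

end Node

end FK
end Summit.CriticalPhenomena.PercolationContinuityZ3.Theorems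

end
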